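import Literature.MathematicalPhysics.QuantumFieldTheory.BalabanImbrieJaffe1984to88.BIJ88Sect5StatementsPart4
import Literature.MathematicalPhysics.QuantumFieldTheory.BalabanImbrieJaffe1984to88.BIJ85Ineq722Torus

/-!
# `BalabanImbrieJaffe1984to88.BIJ88Theta561Witness` — T. Bałaban, J. Imbrie, A. Jaffe, *Effective action and cluster properties of
the abelian Higgs model*, Commun. Math. Phys. **114** (1988) 257–315 [BalabanImbrieJaffe1988], Sect. 5.6 p. 285 [PDF 29], the
cut-off `θ_k` of (5.6.1), verbatim: *"Let θ_k be a function on T*_η that equals 1 in Λ̄₆^{(k)*}, 0 in Λ̄₅^{(k)*c}, and changes smoothly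
from 0 to 1 in a neighborhood of Λ̄₆^{(k)*} of thickness M = O(1)."*, and Sect. 5.7 p. 291–292 [PDF 35–36], verbatim: *"Resummation
in j will be possible only if Ã̃ is localized to sets like Λ̄₅^{(j)} ∩ Λ̄₆^{(j+1)c}. Thus we write Ã̃ = θ_k(H_{k,loc}A^{(k)} + w₅A′) +
Σ_{j=−1}^{k−1} θ_j(1 − θ_{j+1})w₅A′ = Ã̃_k + Σ_{j=0}^{k−1} Ã̃_j. Here θ_{−1} = 1, and each Ã̃_j is a smooth, small field supported in
Λ̄₅^{(j)} ∩ Λ̄₆^{(j+1)c}"* — the NON-VACUITY of the printed requirements on `θ_k` ON THE TORUS CARRIER OF RECORD, and the NESTING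
`θ_jθ_{j+1} = θ_{j+1}` behind the p. 291 resummation DERIVED from the support clauses alone.

statement-level skeleton of published theorems with citation tags; proofs where landed; nothing here is a claim about the Yang–Mills mass gap

PDF held: `paper:balaban1988-cmp114-bij-abelian-higgs-effective-action` (journal page = PDF page + 256); p. 285 [PDF 29] and p. 291
[PDF 35] rendered and read as images this session (CCITT-G4 ×2, seat folder `renders/original-p029-x2.png`, `renders/original-p035-x2.png`);
p. 274 [PDF 18] (the regions: *"the sets Λ_α^{(j)} are determined by Λ_{α−1}^{(j)} by subtracting collar neighborhoods of width r(e_j)"*,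
*"Λ₀^{(j)} ⊂ Λ₁₃^{(j−1)} for j ≥ 1"*) = `HOME/lit-balaban-r16/renders/cmp114/original-p018-x2.png`.

CITATION HEADER (lean-in-tree rule).  Part of the lit-balaban TYPED SKELETON (HOME `run/shared/lean/pub/lit-balaban/`), reader/owner
seat r16 gen 7 (unit `lit-balaban-r16`; TAKING line HOME/STATUS.md 2026-08-21T19:05Z; second own file of the generation after
`BalabanJaffe1986/BJ86Iteration220Torus`).  WHAT IS REPRODUCED: row `C2.Eq5.6.1-5.6.2` of `HOME/lit-balaban-r16/ROWS-C2-part2.md`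
(owner r16), member `θ_k` — the typed carrier of record is r16 gen 2's `BIJ88Sect5StatementsPart3.IsTheta561 Λ6s Λ5s θ` (the two
SUPPORT clauses *"equals 1 in Λ̄₆^{(k)*}, 0 in Λ̄₅^{(k)*c}"*; its docstring and p31 gen 8's `BIJ88Eq5514Torus` both record that the
smoothness clause is not carried) — and row `C2.Eq5.7.10-5.7.12`, the hypothesis `hnest : ϑ_iϑ_{i+1} = ϑ_{i+1}` of r16 gen 2's
`BIJ88Sect5StatementsPart4.telescope5710`/`eq5710_split` (the p. 291 identity).  Nothing typed before is modified.

WHAT IS PROVED (theorems, two definitions with bodies; 0 `sorry`; no `Prop`-valued fact introduced).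
* §1 (abstract carrier `B`, any sets): `mul_eq_of_isTheta561` — if `θ` carries the support clauses for `(Λ₆, Λ₅)` and `θ′` those for
  `(Λ₆′, Λ₅′)` with `Λ₅′ ⊆ Λ₆` then `θ·θ′ = θ′` pointwise (p. 291's nesting: *"each θ_{j+1} is supported where θ_j = 1"*, by
  `Λ₅^{(j+1)} ⊂ Λ₀^{(j+1)} ⊂ Λ₁₃^{(j)} ⊂ Λ₆^{(j)}`, p. 274); the shifted family `thetaShift θs` (`ϑ₀ = θ_{−1} = 1`, `ϑ_{i+1} = θ_i`),
  `thetaShift_nest`; **`telescope5710_of_isTheta561`** and **`eq5710_of_isTheta561`** = r16's `telescope5710`/`eq5710_split` with `hnest`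
  DISCHARGED from the support clauses of a family `θ_j` on nested regions; `cutProduct_eq_zero_of_not_mem`/`cutProduct_eq_zero_of_mem`
  (the p. 292 support sentence: `θ_j(1 − θ_{j+1})` vanishes off `Λ̄₅^{(j)*}` and on `Λ̄₆^{(j+1)*}`).
* §2 (torus of record, level `n`; `ℓ^∞` torus distance `LatticeFieldCalculus.supDist`; bond stars `BIJ88Sect3Statements.starB` = bonds
  with both end-points in the site set): `distTo Λ x` (the `ℓ^∞` distance from a site to a nonempty finite site set) with
  `distTo_eq_zero_of_mem`, `distTo_le_add` (1-Lipschitz), `abs_distTo_sub_le`; THE WITNESS `theta N Λ₆ b = max(1 − distTo Λ₆ b₋ / N, 0)`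
  (`N` = the collar thickness in η-lattice steps, i.e. print's `M = O(1)` measured in units of `η`): `theta_nonneg`, `theta_le_one`,
  **`theta_eq_one_of_mem_starB`** (*"equals 1 in Λ̄₆^{(k)*}"*), **`theta_eq_zero_of_not_mem_starB`** (*"0 in Λ̄₅^{(k)*c}"*, given that
  `Λ₅` contains the `N`-collar of `Λ₆`: `∀ x, ∀ y ∈ Λ₆, supDist x y ≤ N → x ∈ Λ₅`), `theta_eq_zero_of_le_distTo` (*"in a neighborhood
  of Λ̄₆^{(k)*} of thickness"* `N`: `θ = 0` at every bond whose base point is `≥ N` steps from `Λ₆`), **`abs_theta_sub_theta_le`**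
  (*"changes smoothly from 0 to 1"* as the discrete Lipschitz bound `|θ(b) − θ(b′)| ≤ supDist(b₋, b′₋)/N`, so `|∂^ηθ| ≤ η⁻¹/N = 1/M`),
  **`isTheta561_theta`** (the typed carrier inhabited) and **`exists_isTheta561_lipschitz`**.
HONEST SCOPE.  The witness is ONE admissible choice (print: any such function); "smoothly" is rendered as the first-order discrete
Lipschitz bound at scale `N` — higher difference quotients of this piecewise-linear profile are `O(1/N)` but not `O(N^{−m})`, and no
claim is made that the paper needs more than first order; the regions `Λ₅^{(k)} ⊃ Λ₆^{(k)}` and the collar width (`r(e_k) ≫ M`,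
p. 274) enter only through the displayed collar hypothesis; `M = O(1)` in physical units is `N = M/η` lattice steps (not instantiated).
Imports: r16's `BIJ88Sect5StatementsPart4` (→ `Part3`: `IsTheta561`; `telescope5710`), p30/p33's `BIJ85Ineq722Torus` (`supDist_triangle`,
`supDist_runSite_le`; → `B3TorusRadialSums`: `supDist_comm`, `supDist_eq_zero_iff`).  Unit `lit-balaban-r16`
(literature-prover-lit-balaban-r16-g7-0), 2026-08-21.
-/

namespace Literature.MathematicalPhysics.QuantumFieldTheory.BalabanImbrieJaffe1984to88.BIJ88Theta561Witness

open Literature.MathematicalPhysics.QuantumFieldTheory.Balaban1983to89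
open BIJ88Sect3Statements (starB mem_starB)
open BIJ88Sect5StatementsPart3 (IsTheta561)
open BIJ88Sect5StatementsPart4 (telescope5710 eq5710_split)
open LatticeFieldCalculus (supDist runSite runSite_zero runSite_succ)
open BIJ85Ineq722Torus (supDist_triangle supDist_runSite_le)
open B3TorusRadialSums (supDist_comm supDist_eq_zero_iff)
open scoped BigOperators

noncomputable section

/-! ## §1 The nesting `θ_jθ_{j+1} = θ_{j+1}` from the support clauses, and the p. 291 resummation identity -/

section Abstract

variable {B : Type*}

/-- kernel, p. 291 [PDF 35]: if `θ` *"equals 1 in"* `Λ₆` and `θ′` *"equals 0 in"* the complement of `Λ₅′` with `Λ₅′ ⊆ Λ₆` (the regions of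
the next step lie inside `Λ₆` of the present one, p. 274), then `θ·θ′ = θ′` — the NESTING used in the resummation of p. 291.
[cite: BalabanImbrieJaffe1988, (5.7.10) p.291] -/
theorem mul_eq_of_isTheta561 {Λ6 Λ5 Λ6' Λ5' : Set B} {θ θ' : B → ℝ} (h : IsTheta561 Λ6 Λ5 θ) (h' : IsTheta561 Λ6' Λ5' θ')
    (hsub : Λ5' ⊆ Λ6) (b : B) : θ b * θ' b = θ' b := by
  by_cases hb : b ∈ Λ5'
  · rw [h.1 b (hsub hb), one_mul]
  · rw [h'.2 b hb, mul_zero]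

/-- The shifted family of p. 291: `ϑ₀ = θ_{−1} = 1`, `ϑ_{i+1} = θ_i` (*"Here θ_{−1} = 1"*). [cite: BalabanImbrieJaffe1988, (5.7.10) p.291] -/
def thetaShift (θs : ℕ → B → ℝ) : ℕ → B → ℝ
  | 0 => 1
  | i + 1 => θs i

/-- kernel: `ϑ₀ = θ_{−1} = 1`. [cite: BalabanImbrieJaffe1988, (5.7.10) p.291] -/
@[simp] theorem thetaShift_zero (θs : ℕ → B → ℝ) : thetaShift θs 0 = 1 := rfl

/-- kernel: `ϑ_{i+1} = θ_i`. [cite: BalabanImbrieJaffe1988, (5.7.10) p.291] -/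
@[simp] theorem thetaShift_succ (θs : ℕ → B → ℝ) (i : ℕ) : thetaShift θs (i + 1) = θs i := rfl

/-- kernel: for a family `θ_j` carrying the support clauses on regions with `Λ₅^{(j+1)} ⊆ Λ₆^{(j)}` (as bond sets), the shifted family is
NESTED: `ϑ_iϑ_{i+1} = ϑ_{i+1}` — the hypothesis `hnest` of `BIJ88Sect5StatementsPart4.telescope5710`. [cite: BalabanImbrieJaffe1988, (5.7.10) p.291] -/
theorem thetaShift_nest {θs : ℕ → B → ℝ} {Λ6s Λ5s : ℕ → Set B} (hθ : ∀ j, IsTheta561 (Λ6s j) (Λ5s j) (θs j))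
    (hreg : ∀ j, Λ5s (j + 1) ⊆ Λ6s j) (i : ℕ) : thetaShift θs i * thetaShift θs (i + 1) = thetaShift θs (i + 1) := by
  cases i with
  | zero => simp
  | succ i =>
    funext b
    simp only [thetaShift_succ, Pi.mul_apply]
    exact mul_eq_of_isTheta561 (hθ i) (hθ (i + 1)) (hreg i) b

/-- **p. 291, the telescoping with `hnest` DISCHARGED**: for such a family, `θ_k + Σ_{j=−1}^{k−1} θ_j(1 − θ_{j+1}) = 1` pointwise
(written with `ϑ_i = θ_{i−1}`). [cite: BalabanImbrieJaffe1988, (5.7.10) p.291] -/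
theorem telescope5710_of_isTheta561 {θs : ℕ → B → ℝ} {Λ6s Λ5s : ℕ → Set B} (hθ : ∀ j, IsTheta561 (Λ6s j) (Λ5s j) (θs j))
    (hreg : ∀ j, Λ5s (j + 1) ⊆ Λ6s j) (k : ℕ) :
    θs k + ∑ i ∈ Finset.range (k + 1), thetaShift θs i * (1 - thetaShift θs (i + 1)) = 1 :=
  telescope5710 (thetaShift θs) rfl (thetaShift_nest hθ hreg) k

/-- **p. 291 last display, with `hnest` DISCHARGED**: `θ_k(HA + w₅A′) + Σ_{j=−1}^{k−1} θ_j(1 − θ_{j+1})·w₅A′ = θ_kHA + w₅A′` pointwise for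
every family `θ_j` carrying the support clauses on nested regions (r16's `eq5710_split` fed by `thetaShift_nest`).
[cite: BalabanImbrieJaffe1988, (5.7.10) p.291] -/
theorem eq5710_of_isTheta561 {θs : ℕ → B → ℝ} {Λ6s Λ5s : ℕ → Set B} (hθ : ∀ j, IsTheta561 (Λ6s j) (Λ5s j) (θs j))
    (hreg : ∀ j, Λ5s (j + 1) ⊆ Λ6s j) (k : ℕ) (HA w5A : B → ℝ) :
    θs k * (HA + w5A) + ∑ i ∈ Finset.range (k + 1), thetaShift θs i * (1 - thetaShift θs (i + 1)) * w5A = θs k * HA + w5A :=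
  eq5710_split (thetaShift θs) rfl (thetaShift_nest hθ hreg) k HA w5A

/-- kernel, p. 292 first line *"each Ã̃_j is … supported in Λ̄₅^{(j)} ∩ Λ̄₆^{(j+1)c}"* — first half: the cut product `θ_j(1 − θ_{j+1})`
vanishes OFF `Λ̄₅^{(j)*}`. [cite: BalabanImbrieJaffe1988, (5.7.10) p.292] -/
theorem cutProduct_eq_zero_of_not_mem {Λ6 Λ5 : Set B} {θ : B → ℝ} (h : IsTheta561 Λ6 Λ5 θ) (θ' : B → ℝ) {b : B}
    (hb : b ∉ Λ5) : θ b * (1 - θ' b) = 0 := by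
  rw [h.2 b hb, zero_mul]

/-- kernel, p. 292 first line — second half: `θ_j(1 − θ_{j+1})` vanishes ON `Λ̄₆^{(j+1)*}`. [cite: BalabanImbrieJaffe1988, (5.7.10) p.292] -/
theorem cutProduct_eq_zero_of_mem (θ : B → ℝ) {Λ6' Λ5' : Set B} {θ' : B → ℝ} (h' : IsTheta561 Λ6' Λ5' θ') {b : B}
    (hb : b ∈ Λ6') : θ b * (1 - θ' b) = 0 := by
  rw [h'.1 b hb, sub_self, mul_zero]

end Abstract

/-! ## §2 The witness on the torus of record -/

section Torus

variable {P : Params} {n : ℕ}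

/-- The `ℓ^∞` torus distance (in lattice steps) from a site to a nonempty finite set of sites. [cite: BalabanImbrieJaffe1988, Sect. 5.6 p.285] -/
def distTo (Λ : Finset (Balaban1983to89.Site P n)) (h : Λ.Nonempty) (x : Balaban1983to89.Site P n) : ℕ :=
  Λ.inf' h fun y => supDist x y

/-- kernel: the distance to `Λ` vanishes on `Λ`. [cite: BalabanImbrieJaffe1988, Sect. 5.6 p.285] -/
theorem distTo_eq_zero_of_mem {Λ : Finset (Balaban1983to89.Site P n)} (h : Λ.Nonempty) {x : Balaban1983to89.Site P n}
    (hx : x ∈ Λ) : distTo Λ h x = 0 := by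
  apply Nat.eq_zero_of_le_zero
  calc distTo Λ h x ≤ supDist x x := Finset.inf'_le (fun y => supDist x y) hx
    _ = 0 := (supDist_eq_zero_iff x x).mpr rfl

/-- kernel: `m ≤ distTo Λ x` iff every point of `Λ` is at distance `≥ m` from `x`. [cite: BalabanImbrieJaffe1988, Sect. 5.6 p.285] -/
theorem le_distTo_iff {Λ : Finset (Balaban1983to89.Site P n)} (h : Λ.Nonempty) {x : Balaban1983to89.Site P n} {m : ℕ} :
    m ≤ distTo Λ h x ↔ ∀ y ∈ Λ, m ≤ supDist x y :=
  Finset.le_inf'_iff h _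

/-- kernel: the distance to a set is 1-Lipschitz for the torus distance: `distTo Λ x ≤ supDist x x′ + distTo Λ x′`.
[cite: BalabanImbrieJaffe1988, Sect. 5.6 p.285] -/
theorem distTo_le_add {Λ : Finset (Balaban1983to89.Site P n)} (h : Λ.Nonempty) (x x' : Balaban1983to89.Site P n) :
    distTo Λ h x ≤ supDist x x' + distTo Λ h x' := by
  obtain ⟨y, hy, hyeq⟩ := Finset.exists_mem_eq_inf' h fun y => supDist x' y
  calc distTo Λ h x ≤ supDist x y := Finset.inf'_le (fun y => supDist x y) hy
    _ ≤ supDist x x' + supDist x' y := supDist_triangle x x' y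
    _ = supDist x x' + distTo Λ h x' := by unfold distTo; rw [hyeq]

/-- kernel: `|distTo Λ x − distTo Λ x′| ≤ supDist x x′` (real form). [cite: BalabanImbrieJaffe1988, Sect. 5.6 p.285] -/
theorem abs_distTo_sub_le {Λ : Finset (Balaban1983to89.Site P n)} (h : Λ.Nonempty) (x x' : Balaban1983to89.Site P n) :
    |(distTo Λ h x : ℝ) - distTo Λ h x'| ≤ supDist x x' := by
  have h1 : (distTo Λ h x : ℝ) ≤ supDist x x' + distTo Λ h x' := by exact_mod_cast distTo_le_add h x x'
  have h2 : (distTo Λ h x' : ℝ) ≤ supDist x x' + distTo Λ h x := by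
    rw [supDist_comm]; exact_mod_cast distTo_le_add h x' x
  rw [abs_sub_le_iff]
  constructor <;> linarith

/-- kernel: the two end-points of an η-bond are at torus distance `≤ 1`. [cite: BalabanImbrieJaffe1988, Sect. 5.6 p.285] -/
theorem supDist_src_tgt_le (b : PBond P n) : supDist b.src b.tgt ≤ 1 := by
  have h : runSite b.src b.dir 1 = b.tgt := by
    rw [runSite_succ, runSite_zero]; rfl
  simpa [h] using supDist_runSite_le b.src b.dir 1

/-- **THE WITNESS** p. 285 [PDF 29]: `θ(b) = max(1 − dist_∞(b₋, Λ₆)/N, 0)` — piecewise linear in the `ℓ^∞` distance of the base point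
`b₋` of the bond to the site set `Λ₆`, collar thickness `N` lattice steps (print's `M = O(1)` in units of `η`); `θ = 0` if `Λ₆ = ∅`.
[cite: BalabanImbrieJaffe1988, (5.6.1) p.285] -/
def theta (N : ℕ) (Λ6 : Finset (Balaban1983to89.Site P n)) (b : PBond P n) : ℝ :=
  if h : Λ6.Nonempty then max (1 - (distTo Λ6 h b.src : ℝ) / N) 0 else 0

/-- kernel: `0 ≤ θ`. [cite: BalabanImbrieJaffe1988, (5.6.1) p.285] -/
theorem theta_nonneg (N : ℕ) (Λ6 : Finset (Balaban1983to89.Site P n)) (b : PBond P n) : 0 ≤ theta N Λ6 b := by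
  unfold theta
  split_ifs
  · exact le_max_right _ _
  · exact le_rfl

/-- kernel: `θ ≤ 1`. [cite: BalabanImbrieJaffe1988, (5.6.1) p.285] -/
theorem theta_le_one (N : ℕ) (Λ6 : Finset (Balaban1983to89.Site P n)) (b : PBond P n) : theta N Λ6 b ≤ 1 := by
  unfold theta
  split_ifs
  · refine max_le ?_ zero_le_one
    have : 0 ≤ (distTo Λ6 ‹_› b.src : ℝ) / N := by positivity
    linarith
  · exact zero_le_one

/-- **"equals 1 in Λ̄₆^{(k)*}"** p. 285 [PDF 29]: on every bond with both end-points in `Λ₆` (in fact whenever the base point lies in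
`Λ₆`), `θ = 1`. [cite: BalabanImbrieJaffe1988, (5.6.1) p.285] -/
theorem theta_eq_one_of_mem_starB (N : ℕ) {Λ6 : Finset (Balaban1983to89.Site P n)} {b : PBond P n} (hb : b ∈ starB Λ6) :
    theta N Λ6 b = 1 := by
  have hsrc : b.src ∈ Λ6 := ((mem_starB Λ6 b).1 hb).1
  have hne : Λ6.Nonempty := ⟨b.src, hsrc⟩
  unfold theta
  rw [dif_pos hne, distTo_eq_zero_of_mem hne hsrc, Nat.cast_zero, zero_div, sub_zero]
  exact max_eq_left zero_le_one

/-- **"in a neighborhood of Λ̄₆^{(k)*} of thickness M"** p. 285 [PDF 29]: `θ = 0` at every bond whose base point is at least `N` steps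
away from `Λ₆`. [cite: BalabanImbrieJaffe1988, (5.6.1) p.285] -/
theorem theta_eq_zero_of_le_distTo {N : ℕ} (hN : 0 < N) {Λ6 : Finset (Balaban1983to89.Site P n)} (h : Λ6.Nonempty)
    {b : PBond P n} (hfar : N ≤ distTo Λ6 h b.src) : theta N Λ6 b = 0 := by
  unfold theta
  rw [dif_pos h]
  refine max_eq_right ?_
  have hN' : (0 : ℝ) < N := by exact_mod_cast hN
  have hle : (N : ℝ) ≤ distTo Λ6 h b.src := by exact_mod_cast hfar
  have : 1 ≤ (distTo Λ6 h b.src : ℝ) / N := by rw [le_div_iff₀ hN', one_mul]; exact hle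
  linarith

/-- **"0 in Λ̄₅^{(k)*c}"** p. 285 [PDF 29]: if `Λ₅` contains the `N`-collar of `Λ₆` (every site within `ℓ^∞` distance `N` of `Λ₆` lies in
`Λ₅` — print: `Λ₆^{(k)}` is `Λ₅^{(k)}` minus a collar of width `r(e_k) ≫ M`, p. 274), then `θ = 0` on every bond NOT in `Λ̄₅*` (one end-point
outside `Λ₅`). [cite: BalabanImbrieJaffe1988, (5.6.1) p.285] -/
theorem theta_eq_zero_of_not_mem_starB {N : ℕ} (hN : 0 < N) {Λ6 Λ5 : Finset (Balaban1983to89.Site P n)}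
    (hcollar : ∀ x, ∀ y ∈ Λ6, supDist x y ≤ N → x ∈ Λ5) {b : PBond P n} (hb : b ∉ starB Λ5) : theta N Λ6 b = 0 := by
  by_cases h : Λ6.Nonempty
  · refine theta_eq_zero_of_le_distTo hN h ((le_distTo_iff h).2 fun y hy => ?_)
    by_contra hlt
    have hlt : supDist b.src y < N := Nat.lt_of_not_le hlt
    have hsrc : b.src ∈ Λ5 := hcollar b.src y hy hlt.le
    have htgt : b.tgt ∈ Λ5 := by
      refine hcollar b.tgt y hy ?_
      have h1 : supDist b.tgt y ≤ supDist b.tgt b.src + supDist b.src y := supDist_triangle b.tgt b.src y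
      have h2 : supDist b.tgt b.src ≤ 1 := by rw [supDist_comm]; exact supDist_src_tgt_le b
      omega
    exact hb ((mem_starB Λ5 b).2 ⟨hsrc, htgt⟩)
  · unfold theta; rw [dif_neg h]

/-- **"changes smoothly from 0 to 1"** p. 285 [PDF 29], as the discrete Lipschitz bound at scale `N`:
`|θ(b) − θ(b′)| ≤ dist_∞(b₋, b′₋)/N` (so the η-gradient of `θ` is at most `η⁻¹/N = 1/M` in absolute value).
[cite: BalabanImbrieJaffe1988, (5.6.1) p.285] -/
theorem abs_theta_sub_theta_le {N : ℕ} (hN : 0 < N) (Λ6 : Finset (Balaban1983to89.Site P n)) (b b' : PBond P n) :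
    |theta N Λ6 b - theta N Λ6 b'| ≤ (supDist b.src b'.src : ℝ) / N := by
  have hN' : (0 : ℝ) < N := by exact_mod_cast hN
  unfold theta
  by_cases h : Λ6.Nonempty
  · rw [dif_pos h, dif_pos h]
    calc |max (1 - (distTo Λ6 h b.src : ℝ) / N) 0 - max (1 - (distTo Λ6 h b'.src : ℝ) / N) 0|
        ≤ |(1 - (distTo Λ6 h b.src : ℝ) / N) - (1 - (distTo Λ6 h b'.src : ℝ) / N)| := abs_max_sub_max_le_abs _ _ _
      _ = |(distTo Λ6 h b.src : ℝ) - distTo Λ6 h b'.src| / N := by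
          rw [show (1 - (distTo Λ6 h b.src : ℝ) / N) - (1 - (distTo Λ6 h b'.src : ℝ) / N)
              = -(((distTo Λ6 h b.src : ℝ) - distTo Λ6 h b'.src) / N) by ring, abs_neg, abs_div, abs_of_pos hN']
      _ ≤ (supDist b.src b'.src : ℝ) / N := by gcongr; exact abs_distTo_sub_le h b.src b'.src
  · rw [dif_neg h, dif_neg h, sub_zero, abs_zero]
    positivity

/-- **The typed carrier inhabited**: under the collar hypothesis the witness carries r16's support clauses `IsTheta561` for the bond sets
`Λ̄₆* = starB Λ₆`, `Λ̄₅* = starB Λ₅`. [cite: BalabanImbrieJaffe1988, (5.6.1) p.285] -/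
theorem isTheta561_theta {N : ℕ} (hN : 0 < N) {Λ6 Λ5 : Finset (Balaban1983to89.Site P n)}
    (hcollar : ∀ x, ∀ y ∈ Λ6, supDist x y ≤ N → x ∈ Λ5) :
    IsTheta561 (↑(starB Λ6) : Set (PBond P n)) (↑(starB Λ5) : Set (PBond P n)) (theta N Λ6) :=
  ⟨fun _ hb => theta_eq_one_of_mem_starB N (Finset.mem_coe.1 hb),
    fun _ hb => theta_eq_zero_of_not_mem_starB hN hcollar fun h' => hb (Finset.mem_coe.2 h')⟩

/-- **NON-VACUITY of the printed requirements on `θ_k`** p. 285 [PDF 29]: for site sets `Λ₆`, `Λ₅` of the η-lattice torus with `Λ₅`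
containing the `N`-collar of `Λ₆` (`N ≥ 1` lattice steps) there IS a function `θ` on bonds that equals `1` on `Λ̄₆*`, `0` off `Λ̄₅*`, takes
values in `[0, 1]`, and changes from `0` to `1` at rate at most `1/N` per lattice step. [cite: BalabanImbrieJaffe1988, (5.6.1) p.285] -/
theorem exists_isTheta561_lipschitz {N : ℕ} (hN : 0 < N) {Λ6 Λ5 : Finset (Balaban1983to89.Site P n)}
    (hcollar : ∀ x, ∀ y ∈ Λ6, supDist x y ≤ N → x ∈ Λ5) :
    ∃ θ : PBond P n → ℝ, IsTheta561 (↑(starB Λ6) : Set (PBond P n)) (↑(starB Λ5) : Set (PBond P n)) θ ∧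
      (∀ b, 0 ≤ θ b ∧ θ b ≤ 1) ∧ ∀ b b', |θ b - θ b'| ≤ (supDist b.src b'.src : ℝ) / N :=
  ⟨theta N Λ6, isTheta561_theta hN hcollar, fun b => ⟨theta_nonneg N Λ6 b, theta_le_one N Λ6 b⟩,
    abs_theta_sub_theta_le hN Λ6⟩

end Torus

end

end Literature.MathematicalPhysics.QuantumFieldTheory.BalabanImbrieJaffe1984to88.BIJ88Theta561Witness
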